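import Summits.PneNP.PneNP.Theses.RamseyUncertifiable
import Literature.Combinatorics.SimpleGraph.LasserreCliqueCover

/-!
# crux-plan `johnson-scheme-modular-blindness` for `SosUncertainty` (stmt-PneNP-9815): NO SKELETON —
# the typed DECISION PROGRAMME for the crux's named falsifier (Frankl–Wilson / Johnson-class graphs)

Seat: planner-cruxplan-stmt-PneNP-9815-johnson-scheme-modul-0 (2026-08-16). Companion line card:
`Cruxes/SosUncertainty/Lines/johnson-scheme-modular-blindness.md` (verdict `no-skeleton`, reasons, hand-off).

The idea (crux-ideate r1, ideator 2; card body lost with that seat's folder, reconstructed from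
`Ideas/ideas-index.md` + TRIAGE r1-1/2/3): compute `las_t` of the Frankl–Wilson graphs EXACTLY through
`S_m`-invariant moment vectors living in the Terwilliger algebra of the Johnson scheme `J(m, p²−1)`
(Schrijver 2005 / Laurent 2007 block-diagonalisation; Potechin's "symmetry and a good story"
pseudo-expectations), and so DECIDE the crux's registered why-might-fail. Its two outcomes are

* KILL: some fixed level `t₀` certifies `α, ω ≤ n^{ε}` for every `ε` on `FW_p` (`p → ∞`) — that is
  `FWKill t₀` below, and `not_sosUncertainty_of_fwKill` (PROVED) turns it into `¬ SosUncertainty`: a target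
  for the standing disprover (`Disproof.lean`, near-miss (4)), not a line skeleton;
* BLINDNESS: `ModularSideBlind` / `FWUncertainty` — UP_t ON the FW family, a RUNG parallel to
  `PaleySosRung`; `fwUncertainty_of_sosUncertainty` (PROVED, closes the `sorry` of
  `SketchIdeator3.fwUncertainty_of_sosUncertainty`) shows it is a CONSEQUENCE of the crux, and nothing
  here or in print makes it imply the ∀-crux (lower bounds on `las_t` travel only UP induced containment;
  Ramsey graphs contain induced Johnson-class graphs only at logarithmic size).

Hence no `SosUncertainty_of`: any composition would need a universality stub ("UP_t fails, if at all, on a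
Johnson-class graph") with no mechanism behind it — a costume. This file therefore deliberately contains
NO theorem concluding the crux; it is sorry-free and records, type-checked, what the line hands over.

Disproof.lean used: near-miss (4) (FW anatomy: clique side = non-modular RCW, level-1-type; stable side =
modular FW theorem, "SoS degree grows with the modulus" expected; `n^{o(1)}` needs `p → ∞`) fixes the
quantifier shape of `FWKill`/`ModularSideBlind` (uniform in `p` at FIXED `t`); (b) `prod_bot_le_card` and
(3) (level 1 tight on vertex-transitive graphs) are why only levels `≥ 2` matter here;
`inv_le_of_boundedAlphaFamily` is why a kill needs BOTH `α, ω` unbounded (true for FW_p as `p → ∞`).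
-/

set_option linter.dupNamespace false

namespace Summit.PneNP.PneNP.Cruxes.SosUncertainty.JohnsonSchemeModularBlindness

open Literature.Combinatorics.SimpleGraph Finset
open Summit.PneNP.PneNP.Theses.RamseyUncertifiable (SosUncertainty)

/-! ## Objects -/

/-- The JOHNSON-CLASS graph `J(m,k;L)`: vertices the `k`-subsets of `[m]`, `A ~ B` iff `A ≠ B` and
`|A ∩ B| ∈ L` — a union of classes of the Johnson association scheme `J(m,k)`; its automorphism group
contains `S_m`, and `S_m`-invariant level-`t` moment matrices lie in the (poly(`m`)-dimensional for fixed
`k,t`) algebra spanned by orbitals of `S_m` on `≤ t`-sets of `k`-sets. [Delsarte 1973; Schrijver 2005] -/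
def johnsonClassGraph (m k : ℕ) (L : Finset ℕ) : SimpleGraph {A : Finset (Fin m) // A.card = k} :=
  SimpleGraph.fromRel fun A B => (A.1 ∩ B.1).card ∈ L

/-- The Frankl–Wilson graph `FW_p` (verbatim `SketchIdeator3.fwGraph`): vertices the `(p²−1)`-subsets
of `[p³]`, `A ~ B` iff `|A ∩ B| ≡ −1 (mod p)`. Stable sets = families omitting the residue `−1 ≡ k`
(modular Frankl–Wilson theorem: `≤ C(p³, p−1)`); cliques = families with all intersections in
`{p−1, 2p−1, …, p²−p−1}` (non-modular Ray-Chaudhuri–Wilson: `≤ C(p³, p−1)`); `n = C(p³, p²−1)`, so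
`hom(FW_p) ≤ n^{O(1/p)}`. [Frankl–Wilson 1981, doi:10.1007/BF02579457] -/
def fwGraph (p : ℕ) : SimpleGraph {A : Finset (Fin (p ^ 3)) // A.card = p ^ 2 - 1} :=
  SimpleGraph.fromRel fun A B => (A.1 ∩ B.1).card % p = p - 1

/-- `FW_p` is the Johnson-class graph of `[p³], k = p² − 1, L = {ℓ < p² − 1 : ℓ ≡ −1 (mod p)}` (same
adjacency; recorded as the dictionary, not used below). -/
def fwClasses (p : ℕ) : Finset ℕ := (Finset.range (p ^ 2 - 1)).filter fun ℓ => ℓ % p = p - 1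

/-- Vertex count of `FW_p`: `n = C(p³, p² − 1)`. -/
theorem card_fwVertices (p : ℕ) :
    Fintype.card {A : Finset (Fin (p ^ 3)) // A.card = p ^ 2 - 1} = (p ^ 3).choose (p ^ 2 - 1) := by
  rw [Fintype.card_finset_len, Fintype.card_fin]

/-! ## The three statements the line is about -/

/-- RUNG (= `SketchIdeator3.FWUncertainty`, verbatim): UP_t ON the Frankl–Wilson family, uniformly in
`p` at each fixed level `t`. Implied by the crux (`fwUncertainty_of_sosUncertainty`); does NOT imply it. -/
def FWUncertainty : Prop :=
  ∀ t : ℕ, 1 ≤ t → ∃ δ : ℝ, 0 < δ ∧ ∃ p₀ : ℕ, ∀ p ≥ p₀, p.Prime →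
    (((p ^ 3).choose (p ^ 2 - 1) : ℕ) : ℝ) ^ δ ≤
      lasserreStableBound (fwGraph p) t * lasserreStableBound (fwGraph p)ᶜ t

/-- MODULAR BLINDNESS (one-sided, stronger than `FWUncertainty`; the idea's actual conjecture): at every
FIXED level `t`, Lasserre cannot prove the modular Frankl–Wilson theorem with polynomial loss uniformly in
the modulus — `las_t(FW_p) ≥ n^{δ_t}` for all large primes `p` (truth: `α(FW_p) ≤ C(p³,p−1) = n^{O(1/p)}`).
The natural proof route is an `S_{p³}`-invariant pseudo-moment construction in the Terwilliger algebra of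
`J(p³, p²−1)` (Potechin-style "good story"); no SoS degree lower bound for mod-`p` intersection theorems is
in print (Disproof near-miss (4)). -/
def ModularSideBlind : Prop :=
  ∀ t : ℕ, 1 ≤ t → ∃ δ : ℝ, 0 < δ ∧ ∃ p₀ : ℕ, ∀ p ≥ p₀, p.Prime →
    (((p ^ 3).choose (p ^ 2 - 1) : ℕ) : ℝ) ^ δ ≤ lasserreStableBound (fwGraph p) t

/-- KILL SHAPE at a fixed level `t₀`: for every `ε > 0` there are arbitrarily large primes `p` with
`las_{t₀}(FW_p) · las_{t₀}(FW_pᶜ) < n^{ε}` — "level `t₀` sees FW on both sides". By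
`not_sosUncertainty_of_fwKill` this refutes the crux; it is the disprover's target, decided (for small
`p, t₀`) by the block-diagonalised SDP and in general by an analytic bound on the invariant SDP. -/
def FWKill (t₀ : ℕ) : Prop :=
  1 ≤ t₀ ∧ ∀ ε : ℝ, 0 < ε → ∀ p₀ : ℕ, ∃ p ≥ p₀, p.Prime ∧
    lasserreStableBound (fwGraph p) t₀ * lasserreStableBound (fwGraph p)ᶜ t₀ <
      (((p ^ 3).choose (p ^ 2 - 1) : ℕ) : ℝ) ^ ε

/-! ## Proved glue: transports and the decision logic -/

/-- A graph isomorphism induces an isomorphism of the complements. [folklore] -/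
def isoCompl {V W : Type*} {G : SimpleGraph V} {H : SimpleGraph W} (φ : G ≃g H) : Gᶜ ≃g Hᶜ :=
  { φ.toEquiv with
    map_rel_iff' := fun {a b} => by
      simp only [SimpleGraph.compl_adj]
      exact (φ.toEquiv.injective.ne_iff).and (not_congr φ.map_rel_iff') }

/-- For a prime `p`, `p ≤ n = C(p³, p² − 1)` (indeed `p² ≤ n`). -/
theorem le_card_fw {p : ℕ} (hp : p.Prime) : p ≤ (p ^ 3).choose (p ^ 2 - 1) := by
  have h1 : 1 ≤ p := hp.one_lt.le
  have hp2 : 1 ≤ p ^ 2 := Nat.one_le_pow _ _ h1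
  have hk : p ^ 2 - 1 + 1 = p ^ 2 := Nat.sub_add_cancel hp2
  have h23 : p ^ 2 ≤ p ^ 3 := Nat.pow_le_pow_right h1 (by norm_num)
  have hmono : (p ^ 2 - 1 + 1).choose (p ^ 2 - 1) ≤ (p ^ 3).choose (p ^ 2 - 1) :=
    Nat.choose_le_choose _ (hk ▸ h23)
  rw [Nat.choose_succ_self_right, hk] at hmono
  calc p ≤ p ^ 2 := by nlinarith
    _ ≤ (p ^ 3).choose (p ^ 2 - 1) := hmono

/-- TRANSPORT (closes `SketchIdeator3.fwUncertainty_of_sosUncertainty`): the crux implies the FW rung —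
relabel the `(p²−1)`-subsets by `Fin n` (`lasserreStableBound_eq_of_iso`, tree) on both sides. -/
theorem fwUncertainty_of_sosUncertainty : SosUncertainty → FWUncertainty := by
  intro h t ht
  obtain ⟨δ, hδ, n₀, hn⟩ := h t ht
  refine ⟨δ, hδ, n₀, fun p hp hprime => ?_⟩
  set N := (p ^ 3).choose (p ^ 2 - 1) with hN
  have hcard : Fintype.card {A : Finset (Fin (p ^ 3)) // A.card = p ^ 2 - 1} = N := by
    rw [card_fwVertices]
  let e : {A : Finset (Fin (p ^ 3)) // A.card = p ^ 2 - 1} ≃ Fin N := Fintype.equivFinOfCardEq hcard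
  let G' : SimpleGraph (Fin N) := (fwGraph p).comap e.symm
  let φ : G' ≃g fwGraph p := SimpleGraph.Iso.comap e.symm (fwGraph p)
  have h1 : lasserreStableBound G' t = lasserreStableBound (fwGraph p) t :=
    lasserreStableBound_eq_of_iso φ ht
  have h2 : lasserreStableBound G'ᶜ t = lasserreStableBound (fwGraph p)ᶜ t :=
    lasserreStableBound_eq_of_iso (isoCompl φ) ht
  have hNn₀ : n₀ ≤ N := le_trans hp (le_card_fw hprime)
  have key := hn N hNn₀ G'
  rw [h1, h2] at key
  exact key

/-- DECISION LOGIC: the kill shape at some level is exactly the failure of the FW rung. -/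
theorem not_fwUncertainty_iff : ¬ FWUncertainty ↔ ∃ t₀, FWKill t₀ := by
  constructor
  · intro h
    simp only [FWUncertainty, not_forall, not_exists, not_and, not_le] at h
    obtain ⟨t₀, ht₀, h⟩ := h
    refine ⟨t₀, ht₀, fun ε hε p₀ => ?_⟩
    obtain ⟨p, hp, hprime, hlt⟩ := h ε hε p₀
    exact ⟨p, hp, hprime, hlt⟩
  · rintro ⟨t₀, ht₀, h⟩ hU
    obtain ⟨δ, hδ, p₀, hp⟩ := hU t₀ ht₀
    obtain ⟨p, hpp, hprime, hlt⟩ := h δ hδ p₀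
    exact absurd (hp p hpp hprime) (not_le.2 hlt)

/-- KILL CRITERION (formal): a fixed level seeing FW on both sides refutes the crux. -/
theorem not_sosUncertainty_of_fwKill {t₀ : ℕ} (hk : FWKill t₀) : ¬ SosUncertainty :=
  fun h => (not_fwUncertainty_iff.2 ⟨t₀, hk⟩) (fwUncertainty_of_sosUncertainty h)

/-- The one-sided blindness conjecture implies the rung (`las_t(FW_pᶜ) ≥ 1`: a vertex is stable). -/
theorem fwUncertainty_of_modularSideBlind : ModularSideBlind → FWUncertainty := by
  intro h t ht
  obtain ⟨δ, hδ, p₀, hp⟩ := h t ht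
  refine ⟨δ, hδ, p₀, fun p hpp hprime => ?_⟩
  have hpos : 0 < Fintype.card {A : Finset (Fin (p ^ 3)) // A.card = p ^ 2 - 1} := by
    rw [card_fwVertices]; exact lt_of_lt_of_le hprime.pos (le_card_fw hprime)
  obtain ⟨v⟩ := Fintype.card_pos_iff.1 hpos
  have hind : (fwGraph p)ᶜ.IsNIndepSet 1 ({v} : Finset _) :=
    ⟨by rw [Finset.coe_singleton]; exact Set.pairwise_singleton _ _, by simp⟩
  have hone : (1 : ℝ) ≤ lasserreStableBound (fwGraph p)ᶜ t := by
    exact_mod_cast le_lasserreStableBound_of_isNIndepSet (fwGraph p)ᶜ t hind ht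
  have hnn : 0 ≤ lasserreStableBound (fwGraph p) t := lasserreStableBound_nonneg (fwGraph p) t ht
  exact le_trans (hp p hpp hprime) (le_mul_of_one_le_right hnn hone)

/-! ## The line's first stub, for whoever proves the rung (statement only; provable now) -/

/-- SYMMETRISATION (`exists_invariant_near_optimum` of the lost card, sharpened to "same value"): the
feasible region of Laurent's program (22) is convex and `Aut(G)`-invariant and the objective is
invariant, so the Reynolds average of any feasible `y` over a finite group of automorphisms is feasible
with the same value and is invariant. For `FW_p` / Johnson-class graphs with `Γ = S_m` this puts optimal
moments in the Terwilliger algebra of `J(m,k)` (entries depend only on the `S_m`-orbit of `(S, T)`),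
which is what makes `las_t(FW_p)` a finite block-SDP for each `(p, t)` and a symbolic two-parameter
object in general. Size M in Lean (PSD cone closed under sums/positive scalars + `momentMatrix`
reindexing as in `lasserreStableBound_le_of_iso`). -/
def Symmetrisation : Prop :=
  ∀ (V : Type) [Fintype V] [DecidableEq V] (G : SimpleGraph V) (t : ℕ), 1 ≤ t →
    ∀ y : Finset V → ℝ, IsLasserreFeasible G t y →
      ∃ z : Finset V → ℝ, IsLasserreFeasible G t z ∧ ∑ v, z {v} = ∑ v, y {v} ∧
        ∀ φ : G ≃g G, ∀ S : Finset V, z (S.map φ.toEquiv.toEmbedding) = z S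

end Summit.PneNP.PneNP.Cruxes.SosUncertainty.JohnsonSchemeModularBlindness
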